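import Summits.QuantumFields.YangMills.Theses.ParabolicTrajectory
import Summits.QuantumFields.YangMills.Theorems.TunedSequenceExists.Negative.Glue
import Summits.QuantumFields.YangMills.Theorems.TunedSequenceExists.Negative.DominatingFalse
import Summits.QuantumFields.YangMills.Theorems.TunedSequenceExists.Negative.UniformClustering
import Summits.QuantumFields.YangMills.Theorems.ParabolicTrajectoryTunedSequenceExistsStubDlrDecoupling
import Literature.MathematicalPhysics.QuantumLattice.LatticeGaugeDLRCovarianceSplit

/-!
# Line `dirichlet-box-localisation` for the crux `ParabolicTrajectory.TunedSequenceExists`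
# (stmt-QuantumFields-10524) — checked skeleton (crux-plan, round 1, 2026-08-16)

Crux (route `ParabolicTrajectory`, item stmt-QuantumFields-10524, (S) of the thesis): for every
compact simple Lie `G`, faithful unitary `r`, `M ≥ 2` there is a window `(0, θ₀)` of tuned limits
`θ` of `N_1(k) = (M^{n_k})^8 ⟨P ; τ_{M^{n_k}} P⟩_{β_k, 2L_k+1}` along SOME `M`-adic Wilson scheme with
`β_k → ∞` and all `N_t(k)` convergent.  Idea card `Ideas/dirichlet-box-localisation.md` (ideator 2;
triage r1-1/2/3: pass): the only open input of the crux — the finite-volume correlator window lower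
bound `CorrelatorWindowLowerBound` of the disprover's § Glue (`Negative.Glue.weak_iff_lowerBound`)
plus the a-priori bound on `N_t` of § ClauseThree — LOCALISES, by the exact DLR/Markov property of
Wilson's nearest-plaquette action on the torus (tree theorem
`QuantumLattice.wilsonExpectation_toTorusObservable_eq`, proved) and the law of total covariance,
to statements about lattice Yang–Mills in a DIRICHLET BOX OF FIXED PHYSICAL SIZE `3ℓ₀` (in units
`D = Mⁿ`) with frozen, arbitrary boundary links — a femto-universe with dirty walls, every scale of
which sits in Bałaban's small-coupling window once `θ₀` (hence the running coupling `g₁` at scale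
`D`) is chosen first and `ℓ₀ = ℓ₀(g₁) ≍ g₁^{-1/2}` afterwards.

## The line, as three stubs (two PROVED in cycle 1, one open) and a kernel-checked composition

Status after the lead's cycle 1 (2026-08-16): `stub_dlrDecoupling` LANDED (p91336,
`Theorems/ParabolicTrajectoryTunedSequenceExistsStubDlrDecoupling.lean`); `stub_dlrCovarianceSplit`
PROVED from the landed Literature theorem
`Literature.MathematicalPhysics.QuantumLattice.latticeConnectedCorr_ge_of_boxKernel_condCov` (p92574);
the ONLY remaining `sorry` is `stub_boxWindow`, and `TunedSequenceExists_of` takes it as its single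
hypothesis.  Cycle 2 (lead c1, 2026-08-16): no reshape — the stub is certified CRUX-SIZED at the end
of the file (`lowerBound_of_stub_boxWindow`, `not_uniformClustering_of_stub_boxWindow`: it returns
the crux's whole open core for every admissible `(G, r, M)`), no soft route to any clause exists
(Gaussian regime of a fixed torus, RP log-convexity, thermodynamic asymptotics and DLR-localised
covariance lower bounds all fail structurally — lead notes), and it is handed back for promotion.

* `stub_boxWindow` — **C⁺, the load-bearing stub (size XL; Bałaban-class, unprinted).**  For every
  `(G, r, M ≥ 2)` there are `θ₁ > 0`, `C ≥ 0`, `ℓ₀ ≥ 1` with `64 C² ≤ θ₁ ℓ₀⁸`, couplings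
  `β'(n) → ∞` (intended: the asymptotic-freedom line for unit `Mⁿ` at a fixed small running
  coupling `g₁`, `θ₁ ≍ κ g₁⁴`), and EXCEPTIONAL boundary-data sets `Bad n R c` of torus
  probability `≤ δ n` with `M^{8n} δ n → 0` (triage r1-1 sharpen (ii); `Bad = ∅` is the conjectured
  strong case "∀η"), such that eventually in `n`, with `D = Mⁿ`:
  (P) every torus Wilson state at `β ≥ β'(n)` on tori `2L+1 ≥ 2L₀(n)+1` charges `Bad n R c` at most
      `δ n`, for all box half-sides `D/4 ≤ R ≤ 3ℓ₀D` and centres `c`;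
  (U) **femto-box lower bound**: for every boundary datum `η ∉ Bad`, the connected two-point
      function of the action density `P = tr F²` at separation `D e₀` under the Dirichlet-box DLR
      kernel `ymSpecification r.ρ (β' n) Λ(3ℓ₀D, 0) η` is `≥ θ₁ D⁻⁸`;
  (O) **dimension-four screening** (interior regularity uniform in the Dirichlet data): for all
      `β ≥ β'(n)`, all boxes `Λ(R, c)` with `D/4 ≤ R ≤ 3ℓ₀D` (triage sharpen (i): no box beyond the
      physical size `3ℓ₀`, so no infrared/uniqueness statement is asked), all plaquette positions
      `x` in the inner half-box and all `η, η' ∉ Bad`, the one-point functions differ by `≤ C/R⁴`.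
  Here `Λ(R, c) = ((box 4 R).image (· + c)) ×ˢ univ` (all positively oriented edges based in the
  cube `c + [-R, R]⁴`).  WHY (U) and (O) are ONE stub: they share the coupling schedule `β'` and
  the aspect `ℓ₀`; split into separately quantified statements their interface is exactly "the
  perturbative horizon of (O) grows at the asymptotic-freedom rate of (U)", i.e. the one-loop
  slope `b(G, r) = 2b₀(G)/T_r`, which the tree cannot name for an abstract compact simple `G` and
  an abstract faithful `r` (no `C₂(G)`, no Dynkin index) — see the line card, § Why merged.
* `stub_dlrCovarianceSplit` — **DLR total-covariance inequality, one box (size M; provable now).**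
  For every coupling, torus `2L+1`, box `Λ(R, c)` fitting the torus with its collar, separation `m`
  and measurable `Bad`: if the box kernel's connected `P₀–P_m` function is `≥ θ` and its one-point
  functions oscillate by `≤ a`, `≤ b` off `Bad`, and the torus state charges `Bad` by `≤ p`, then
  `θ − ab/4 − (θ + 16·(6N)²)p ≤ ⟨P₀ ; P_m⟩_{torus}`.  (DLR identity for `P₀P_m`, `P₀`, `P_m` —
  `wilsonExpectation_toTorusObservable_eq` —, `Cov = E[Cov(·|η)] + Cov(E[P₀|η], E[P_m|η])`,
  `|Cov(h,k)| ≤ osc h · osc k / 4` (Popoviciu + Cauchy–Schwarz), `|P| ≤ 6N`.)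
* `stub_dlrDecoupling` — **DLR decoupling, two separated boxes (size M; provable now).**  Boxes
  `Λ(R, 0) ∋ supp P₀` and `Λ(R, m e₀) ∋ supp P_m` with `2R + 3 ≤ m`: the kernel of their union is a
  product (no plaquette touches both), so `⟨P₀ ; P_m⟩_{torus} = Cov(h₁(η), h₂(η))` with `hᵢ` the
  one-box conditional expectations, whence `|⟨P₀ ; P_m⟩| ≤ ab/4 + 16·(6N)² p`.  This is the
  card's reflection-positivity-free a-priori bound (the disprover's `AprioriBound` without
  `CorrMonotoneNonneg`; the odd side `2L+1` never meets RP).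
* `TunedSequenceExists_of` — **proved here, no `sorry`**: (1) Step A, torus lower bound
  `θ₁/2 ≤ N_1` at `β'(n)` on all tori `L ≥ L₀(n) ⊔ (3ℓ₀Mⁿ+1)` (stub 2 at `R = 3ℓ₀D`, `c = 0`,
  arithmetic `lower_arith`); (2) Step B, `|N_t| ≤ 4⁷C² + 16(6N)²` for all `β ≥ β'(n)`, `t ≥ 1`,
  `L ≥ tD + D` (stub 3 at `R = D/4+1`, arithmetic `apriori_arith`); (3) Step C, EXACT tuning
  `N_1(k) = θ` by the intermediate value theorem on `[β'(n_k), ∞)` (landed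
  `Negative.Glue.exists_ge_corr_eq`: β-continuity + freezing `N_1 → 0` as `β → ∞`), scheme
  `a_k = M^{-(N₀+k)}`, `L_k ≥ (k+2)M^{n_k}`, `β_k ≥ β'(n_k) → ∞`, and diagonal extraction of
  convergent `N_t` from bounded ones (`witness_of_bounded`, the disprover's `window_of_windowBdd`).

## Disproof used (cdisprove gens 1–3, `Cruxes/TunedSequenceExists/Disproof.lean`; landed extracts
`Theorems/TunedSequenceExists/Negative/*`, three of them imported here)

§ Targets is EMPTY and no `_false_without_<H>` theorem exists for this crux; the LoadBearing /
Negative lemmas are honoured as follows.  `TwoLeMFalse` (`2 ≤ M` load-bearing): used — `hM` feeds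
`M^n → ∞`, `12 ≤ M^n` and the IVT lemma.  `UnfaithfulFalse` / `not_window_of_subsingleton` /
`FiniteGroupFalse` (non-degenerate, faithful, CONNECTED `G` load-bearing): the composition is
uniform in `G`; all `G`-dependence sits in `stub_boxWindow` (U), which is false for finite `G`
(frozen Higgs phase: box correlator `≤ C e^{-D}`) and for `U(1)` ((U) needs `b₀ > 0`; (O) is
U(1)-FALSE by the monopole-sheet tear, triage r1-2/r1-3) — any proof of (U) must use both
asymptotic freedom and `π₁`-finiteness/non-abelian unwinding, as the card says.  `AtZeroFalse` /
`DominatingFalse` (§ Ceiling: `β_k` is a TUNED divergence, floor < β_k < b(n_k, L_k)): respected —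
`β_k` is produced by the IVT above `β'(n_k)`, never prescribed.  `UniformClustering` (crux ⇒ no
uniform weak-coupling clustering): consistent — (U) at `β'(n) → ∞` with `θ₁` fixed is exactly a
non-uniform-clustering statement, localised to a box.  `Exponent` (p = 8 canonical): the stubs
produce the canonical power with `θ₀ = θ₁/2 ≍ g₁⁴`.  § ClauseThree warning (odd torus, no RP): the
a-priori bound comes from `stub_dlrDecoupling`, not from `CorrMonotoneNonneg`.  § Glue quantifier
shape (`∀ B`, eventually in `n`): Step A has it (`β'(n) → ∞`, all `n ≥ N₀`, all large `L`).
-/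

noncomputable section

open Filter Topology MeasureTheory
open Literature.MathematicalPhysics.QuantumFieldTheory Literature.MathematicalPhysics.QuantumLattice
open Literature.Probability.LatticeModels (box)
open Summit.QuantumFields.YangMills.Theorems.TunedSequenceExists.Negative.Glue (exists_ge_corr_eq)

namespace Summit.QuantumFields.YangMills.Cruxes.TunedSequenceExists.DirichletBoxLocalisation

/-! ## The three statements (named `Prop`s at fixed data; the registered `stub_*` theorems below
spell them out verbatim under the crux's quantifier prefix, `*_holds` certify the agreement
definitionally, and `Registered.stub_*` are the name-keyed aliases consumed by
`TunedSequenceExists_of` — the device of `Cruxes/SomeWindowSaving/Lines/inert-box-collapse.lean`) -/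

section Statements

variable {G : Type} [Group G] [TopologicalSpace G] [IsTopologicalGroup G] [CompactSpace G]
  [MeasurableSpace G] [BorelSpace G]

/-- **C⁺ — the Dirichlet-box window at fixed `(G, r, M)`** ((P) rare bad boundary data, (U) the
femto-box lower bound at `β'(n)`, (O) dimension-four screening for `β ≥ β'(n)`; see the module
docstring).  The box kernel is the tree's `ymSpecification r.ρ β Λ η` (product Haar on the edges of
`Λ` glued with `η` outside, tilted by `exp(-β S_Λ)`), `Λ = Λ(R, c) = ((box 4 R).image (· + c)) ×ˢ univ`;
`P = r.curvature.F = actionDensity r.ρ` and `P_x = P ∘ configShift (-x)` as in `latticeConnectedCorr`. -/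
def BoxWindow (r : LatticeRep G) (M : ℕ) : Prop :=
  ∃ (θ₁ C : ℝ) (ℓ₀ : ℕ) (β' δ : ℕ → ℝ) (L₀ : ℕ → ℕ)
    (Bad : ℕ → ℕ → (Fin 4 → ℤ) → Set (LGConfig 4 G)),
    0 < θ₁ ∧ 0 ≤ C ∧ 1 ≤ ℓ₀ ∧ 64 * C ^ 2 ≤ θ₁ * (ℓ₀ : ℝ) ^ 8 ∧ Tendsto β' atTop atTop ∧
    (∀ n, 0 ≤ δ n) ∧ Tendsto (fun n => ((M : ℝ) ^ n) ^ 8 * δ n) atTop (𝓝 0) ∧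
    (∀ n R c, MeasurableSet (Bad n R c)) ∧
    ∀ᶠ n in atTop,
      (∀ (β : ℝ) (R L : ℕ) (c : Fin 4 → ℤ), β' n ≤ β → M ^ n ≤ 4 * R → R ≤ 3 * ℓ₀ * M ^ n →
          L₀ n ≤ L →
        (wilsonMeasure (d := 4) (L := 2 * L + 1) r.ρ β)
            {U | torusLift (2 * L + 1) U ∈ Bad n R c} ≤ ENNReal.ofReal (δ n)) ∧
      (∀ η : LGConfig 4 G, η ∉ Bad n (3 * ℓ₀ * M ^ n) 0 →
        θ₁ ≤ ((M : ℝ) ^ n) ^ 8 *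
          ((∫ U, r.curvature.F U * r.curvature.F (configShift (-Pi.single 0 ((M ^ n : ℕ) : ℤ)) U)
              ∂(ymSpecification r.ρ (β' n)
                (((box 4 (3 * ℓ₀ * M ^ n)).image (· + (0 : Fin 4 → ℤ))) ×ˢ Finset.univ) η)) -
            (∫ U, r.curvature.F U
              ∂(ymSpecification r.ρ (β' n)
                (((box 4 (3 * ℓ₀ * M ^ n)).image (· + (0 : Fin 4 → ℤ))) ×ˢ Finset.univ) η)) *
              ∫ U, r.curvature.F (configShift (-Pi.single 0 ((M ^ n : ℕ) : ℤ)) U)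
                ∂(ymSpecification r.ρ (β' n)
                  (((box 4 (3 * ℓ₀ * M ^ n)).image (· + (0 : Fin 4 → ℤ))) ×ˢ Finset.univ) η))) ∧
      (∀ (β : ℝ) (R : ℕ) (c x : Fin 4 → ℤ) (η η' : LGConfig 4 G), β' n ≤ β → M ^ n ≤ 4 * R →
          R ≤ 3 * ℓ₀ * M ^ n → (∀ i, 2 * |x i - c i| ≤ (R : ℤ)) → η ∉ Bad n R c → η' ∉ Bad n R c →
        |(∫ U, r.curvature.F (configShift (-x) U)
              ∂(ymSpecification r.ρ β (((box 4 R).image (· + c)) ×ˢ Finset.univ) η)) -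
            ∫ U, r.curvature.F (configShift (-x) U)
              ∂(ymSpecification r.ρ β (((box 4 R).image (· + c)) ×ˢ Finset.univ) η')| ≤
          C / (R : ℝ) ^ 4)

/-- **DLR total-covariance inequality (one box)** — see the module docstring.  Torus-fit
hypotheses: the box with its collar and both plaquettes lie in `[-L, L]⁴`, a fundamental domain of
the torus of side `2L+1` (`∀ i, |c i| + R + 1 ≤ L`, `m + 1 ≤ L`). -/
def DLRCovarianceSplit (r : LatticeRep G) : Prop :=
  ∀ (β θ a b p : ℝ) (R L m : ℕ) (c : Fin 4 → ℤ) (Bad : Set (LGConfig 4 G)),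
    MeasurableSet Bad → (∀ i, |c i| + R + 1 ≤ (L : ℤ)) → m + 1 ≤ L → 0 ≤ θ → 0 ≤ a → 0 ≤ b →
    0 ≤ p →
    (∀ η : LGConfig 4 G, η ∉ Bad →
      θ ≤ (∫ U, r.curvature.F U * r.curvature.F (configShift (-Pi.single 0 (m : ℤ)) U)
              ∂(ymSpecification r.ρ β (((box 4 R).image (· + c)) ×ˢ Finset.univ) η)) -
            (∫ U, r.curvature.F U
              ∂(ymSpecification r.ρ β (((box 4 R).image (· + c)) ×ˢ Finset.univ) η)) *
              ∫ U, r.curvature.F (configShift (-Pi.single 0 (m : ℤ)) U)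
                ∂(ymSpecification r.ρ β (((box 4 R).image (· + c)) ×ˢ Finset.univ) η)) →
    (∀ η η' : LGConfig 4 G, η ∉ Bad → η' ∉ Bad →
      |(∫ U, r.curvature.F U ∂(ymSpecification r.ρ β (((box 4 R).image (· + c)) ×ˢ Finset.univ) η)) -
          ∫ U, r.curvature.F U
            ∂(ymSpecification r.ρ β (((box 4 R).image (· + c)) ×ˢ Finset.univ) η')| ≤ a) →
    (∀ η η' : LGConfig 4 G, η ∉ Bad → η' ∉ Bad →
      |(∫ U, r.curvature.F (configShift (-Pi.single 0 (m : ℤ)) U)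
            ∂(ymSpecification r.ρ β (((box 4 R).image (· + c)) ×ˢ Finset.univ) η)) -
          ∫ U, r.curvature.F (configShift (-Pi.single 0 (m : ℤ)) U)
            ∂(ymSpecification r.ρ β (((box 4 R).image (· + c)) ×ˢ Finset.univ) η')| ≤ b) →
    (wilsonMeasure (d := 4) (L := 2 * L + 1) r.ρ β) {U | torusLift (2 * L + 1) U ∈ Bad} ≤
        ENNReal.ofReal p →
    θ - a * b / 4 - (θ + 16 * (6 * (r.N : ℝ)) ^ 2) * p ≤
      latticeConnectedCorr r.ρ β (2 * L + 1) r.curvature.F r.curvature.F m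

/-- **DLR decoupling (two separated boxes)** — see the module docstring.  `1 ≤ R` puts `supp P₀`
in `Λ(R, 0)` and `supp P_m` in `Λ(R, m e₀)`; `2R + 3 ≤ m` separates the two collars; `m + R + 1 ≤ L`
fits everything in `[-L, L]⁴`. -/
def DLRDecoupling (r : LatticeRep G) : Prop :=
  ∀ (β a b p : ℝ) (R L m : ℕ) (Bad₁ Bad₂ : Set (LGConfig 4 G)),
    MeasurableSet Bad₁ → MeasurableSet Bad₂ → 1 ≤ R → 2 * R + 3 ≤ m → m + R + 1 ≤ L →
    0 ≤ a → 0 ≤ b → 0 ≤ p →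
    (∀ η η' : LGConfig 4 G, η ∉ Bad₁ → η' ∉ Bad₁ →
      |(∫ U, r.curvature.F U
            ∂(ymSpecification r.ρ β (((box 4 R).image (· + (0 : Fin 4 → ℤ))) ×ˢ Finset.univ) η)) -
          ∫ U, r.curvature.F U
            ∂(ymSpecification r.ρ β (((box 4 R).image (· + (0 : Fin 4 → ℤ))) ×ˢ Finset.univ) η')| ≤
        a) →
    (∀ η η' : LGConfig 4 G, η ∉ Bad₂ → η' ∉ Bad₂ →
      |(∫ U, r.curvature.F (configShift (-Pi.single 0 (m : ℤ)) U)
            ∂(ymSpecification r.ρ β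
              (((box 4 R).image (· + (Pi.single 0 (m : ℤ) : Fin 4 → ℤ))) ×ˢ Finset.univ) η)) -
          ∫ U, r.curvature.F (configShift (-Pi.single 0 (m : ℤ)) U)
            ∂(ymSpecification r.ρ β
              (((box 4 R).image (· + (Pi.single 0 (m : ℤ) : Fin 4 → ℤ))) ×ˢ Finset.univ) η')| ≤
        b) →
    (wilsonMeasure (d := 4) (L := 2 * L + 1) r.ρ β) {U | torusLift (2 * L + 1) U ∈ Bad₁} ≤
        ENNReal.ofReal p →
    (wilsonMeasure (d := 4) (L := 2 * L + 1) r.ρ β) {U | torusLift (2 * L + 1) U ∈ Bad₂} ≤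
        ENNReal.ofReal p →
    |latticeConnectedCorr r.ρ β (2 * L + 1) r.curvature.F r.curvature.F m| ≤
      a * b / 4 + 16 * (6 * (r.N : ℝ)) ^ 2 * p

end Statements

/-- `BoxWindow` under the crux's quantifier prefix. -/
def BoxWindowAll : Prop :=
  ∀ (G : Type) [Group G] [TopologicalSpace G] [IsTopologicalGroup G] [CompactSpace G],
    IsCompactSimpleLieGroup G → letI : MeasurableSpace G := borel G
    haveI : BorelSpace G := ⟨rfl⟩
    ∀ (r : LatticeRep G) (M : ℕ), 2 ≤ M → BoxWindow r M

/-- `DLRCovarianceSplit` for every compact `G` with a lattice representation (no simplicity needed)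
and every Borel structure on `G` (lead's reshape, cycle 1: instance binders `[MeasurableSpace G]
[BorelSpace G]` instead of the `letI := borel G` prefix, so that the registered signature is free of
`:=` before its distinguishing text; the composition instantiates it at `borel G`). -/
def DLRCovarianceSplitAll : Prop :=
  ∀ (G : Type) [Group G] [TopologicalSpace G] [IsTopologicalGroup G] [CompactSpace G]
    [MeasurableSpace G] [BorelSpace G] (r : LatticeRep G), DLRCovarianceSplit r

/-- `DLRDecoupling` for every compact `G` with a lattice representation. -/
def DLRDecouplingAll : Prop :=
  ∀ (G : Type) [Group G] [TopologicalSpace G] [IsTopologicalGroup G] [CompactSpace G],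
    letI : MeasurableSpace G := borel G
    haveI : BorelSpace G := ⟨rfl⟩
    ∀ (r : LatticeRep G), DLRDecoupling r

/-! ## The registered stubs (`sorry` lives ONLY in `stub_boxWindow`; `stub_dlrCovarianceSplit` is proved
from the landed Literature theorem and `stub_dlrDecoupling` landed in wave 1 and is imported) -/

/-- **STUB 1 · `stub_boxWindow` (C⁺; size XL, the hardest; intended engine: Bałaban's 4-d
renormalisation group CMP 109/116/119/122 run in a box of `n + log_M(3ℓ₀)` scales with a
Dirichlet boundary layer and one/two `tr F²` insertions — neither the observables nor the
permanent large-field wall are in print; classical shadow of (O) = non-abelian screening of wall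
flux, triage r1-3 App. A / r1-1 §E′, toys j007103/190/218).** `= BoxWindowAll` verbatim. -/
theorem stub_boxWindow :
    ∀ (G : Type) [Group G] [TopologicalSpace G] [IsTopologicalGroup G] [CompactSpace G],
      IsCompactSimpleLieGroup G → letI : MeasurableSpace G := borel G
      haveI : BorelSpace G := ⟨rfl⟩
      ∀ (r : LatticeRep G) (M : ℕ), 2 ≤ M →
    ∃ (θ₁ C : ℝ) (ℓ₀ : ℕ) (β' δ : ℕ → ℝ) (L₀ : ℕ → ℕ)
        (Bad : ℕ → ℕ → (Fin 4 → ℤ) → Set (LGConfig 4 G)),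
        0 < θ₁ ∧ 0 ≤ C ∧ 1 ≤ ℓ₀ ∧ 64 * C ^ 2 ≤ θ₁ * (ℓ₀ : ℝ) ^ 8 ∧ Tendsto β' atTop atTop ∧
        (∀ n, 0 ≤ δ n) ∧ Tendsto (fun n => ((M : ℝ) ^ n) ^ 8 * δ n) atTop (𝓝 0) ∧
        (∀ n R c, MeasurableSet (Bad n R c)) ∧
        ∀ᶠ n in atTop,
          (∀ (β : ℝ) (R L : ℕ) (c : Fin 4 → ℤ), β' n ≤ β → M ^ n ≤ 4 * R → R ≤ 3 * ℓ₀ * M ^ n →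
              L₀ n ≤ L →
            (wilsonMeasure (d := 4) (L := 2 * L + 1) r.ρ β)
                {U | torusLift (2 * L + 1) U ∈ Bad n R c} ≤ ENNReal.ofReal (δ n)) ∧
          (∀ η : LGConfig 4 G, η ∉ Bad n (3 * ℓ₀ * M ^ n) 0 →
            θ₁ ≤ ((M : ℝ) ^ n) ^ 8 *
              ((∫ U, r.curvature.F U * r.curvature.F (configShift (-Pi.single 0 ((M ^ n : ℕ) : ℤ)) U)
                  ∂(ymSpecification r.ρ (β' n)
                    (((box 4 (3 * ℓ₀ * M ^ n)).image (· + (0 : Fin 4 → ℤ))) ×ˢ Finset.univ) η)) -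
                (∫ U, r.curvature.F U
                  ∂(ymSpecification r.ρ (β' n)
                    (((box 4 (3 * ℓ₀ * M ^ n)).image (· + (0 : Fin 4 → ℤ))) ×ˢ Finset.univ) η)) *
                  ∫ U, r.curvature.F (configShift (-Pi.single 0 ((M ^ n : ℕ) : ℤ)) U)
                    ∂(ymSpecification r.ρ (β' n)
                      (((box 4 (3 * ℓ₀ * M ^ n)).image (· + (0 : Fin 4 → ℤ))) ×ˢ Finset.univ) η))) ∧
          (∀ (β : ℝ) (R : ℕ) (c x : Fin 4 → ℤ) (η η' : LGConfig 4 G), β' n ≤ β → M ^ n ≤ 4 * R →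
              R ≤ 3 * ℓ₀ * M ^ n → (∀ i, 2 * |x i - c i| ≤ (R : ℤ)) → η ∉ Bad n R c → η' ∉ Bad n R c →
            |(∫ U, r.curvature.F (configShift (-x) U)
                  ∂(ymSpecification r.ρ β (((box 4 R).image (· + c)) ×ˢ Finset.univ) η)) -
                ∫ U, r.curvature.F (configShift (-x) U)
                  ∂(ymSpecification r.ρ β (((box 4 R).image (· + c)) ×ˢ Finset.univ) η')| ≤
              C / (R : ℝ) ^ 4) := by
  sorry

/-- **STUB 2 · `stub_dlrCovarianceSplit` — PROVED** (wave 1: the general theorem landed as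
`Literature.MathematicalPhysics.QuantumLattice.latticeConnectedCorr_ge_of_boxKernel_condCov`, p92574,
file `Literature/MathematicalPhysics/QuantumLattice/LatticeGaugeDLRCovarianceSplit.lean`; originally size M; from
`wilsonExpectation_toTorusObservable_eq`, `isProbabilityMeasure_ymSpecification`,
`abs_integral_ymSpecification_le`, `torusProj_injOn_box`, Popoviciu).** `= DLRCovarianceSplitAll`
(reshaped by the lead, cycle 1: stated for every Borel structure `[MeasurableSpace G] [BorelSpace G]`
— strictly more general than the round-1 `letI := borel G` form, and exactly what the wave-1
worker's `CovarianceSplit.covarianceSplitBorelFree` proves). -/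
theorem stub_dlrCovarianceSplit :
    ∀ (G : Type) [Group G] [TopologicalSpace G] [IsTopologicalGroup G] [CompactSpace G]
      [MeasurableSpace G] [BorelSpace G] (r : LatticeRep G),
    ∀ (β θ a b p : ℝ) (R L m : ℕ) (c : Fin 4 → ℤ) (Bad : Set (LGConfig 4 G)),
        MeasurableSet Bad → (∀ i, |c i| + R + 1 ≤ (L : ℤ)) → m + 1 ≤ L → 0 ≤ θ → 0 ≤ a → 0 ≤ b →
        0 ≤ p →
        (∀ η : LGConfig 4 G, η ∉ Bad →
          θ ≤ (∫ U, r.curvature.F U * r.curvature.F (configShift (-Pi.single 0 (m : ℤ)) U)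
                  ∂(ymSpecification r.ρ β (((box 4 R).image (· + c)) ×ˢ Finset.univ) η)) -
                (∫ U, r.curvature.F U
                  ∂(ymSpecification r.ρ β (((box 4 R).image (· + c)) ×ˢ Finset.univ) η)) *
                  ∫ U, r.curvature.F (configShift (-Pi.single 0 (m : ℤ)) U)
                    ∂(ymSpecification r.ρ β (((box 4 R).image (· + c)) ×ˢ Finset.univ) η)) →
        (∀ η η' : LGConfig 4 G, η ∉ Bad → η' ∉ Bad →
          |(∫ U, r.curvature.F U ∂(ymSpecification r.ρ β (((box 4 R).image (· + c)) ×ˢ Finset.univ) η)) -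
              ∫ U, r.curvature.F U
                ∂(ymSpecification r.ρ β (((box 4 R).image (· + c)) ×ˢ Finset.univ) η')| ≤ a) →
        (∀ η η' : LGConfig 4 G, η ∉ Bad → η' ∉ Bad →
          |(∫ U, r.curvature.F (configShift (-Pi.single 0 (m : ℤ)) U)
                ∂(ymSpecification r.ρ β (((box 4 R).image (· + c)) ×ˢ Finset.univ) η)) -
              ∫ U, r.curvature.F (configShift (-Pi.single 0 (m : ℤ)) U)
                ∂(ymSpecification r.ρ β (((box 4 R).image (· + c)) ×ˢ Finset.univ) η')| ≤ b) →
        (wilsonMeasure (d := 4) (L := 2 * L + 1) r.ρ β) {U | torusLift (2 * L + 1) U ∈ Bad} ≤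
            ENNReal.ofReal p →
        θ - a * b / 4 - (θ + 16 * (6 * (r.N : ℝ)) ^ 2) * p ≤
          latticeConnectedCorr r.ρ β (2 * L + 1) r.curvature.F r.curvature.F m := by
  intro G _ _ _ _ _ _ r
  exact Literature.MathematicalPhysics.QuantumLattice.latticeConnectedCorr_ge_of_boxKernel_condCov r

/-- **STUB 3 · `stub_dlrDecoupling` — LANDED** (wave 1, p91336:
`Summits/QuantumFields/YangMills/Theorems/ParabolicTrajectoryTunedSequenceExistsStubDlrDecoupling.lean`,
`…DirichletBoxLocalisation.Decoupling.stub_dlrDecoupling`, sorry-free, axioms standard).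
`= DLRDecouplingAll` verbatim; no longer a stub of this skeleton. -/
theorem dlrDecoupling_landed :
    ∀ (G : Type) [Group G] [TopologicalSpace G] [IsTopologicalGroup G] [CompactSpace G],
      letI : MeasurableSpace G := borel G
      haveI : BorelSpace G := ⟨rfl⟩
      ∀ (r : LatticeRep G), DLRDecoupling r :=
  Summit.QuantumFields.YangMills.Theorems.TunedSequenceExists.DirichletBoxLocalisation.Decoupling.stub_dlrDecoupling

/-! ### Consistency: each named statement IS its registered stub (definitionally) -/

theorem boxWindowAll_holds : BoxWindowAll := stub_boxWindow
theorem dlrCovarianceSplitAll_holds : DLRCovarianceSplitAll := stub_dlrCovarianceSplit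
theorem dlrDecouplingAll_holds : DLRDecouplingAll := dlrDecoupling_landed

/-! ### Name-keyed alias of the one OPEN statement (the hypothesis of the composition;
`DLRCovarianceSplitAll` and `DLRDecouplingAll` are proved: `dlrCovarianceSplitAll_holds`,
`dlrDecouplingAll_holds`) -/
namespace Registered

/-- Alias of `BoxWindowAll` keyed by the registered stub name. -/
abbrev stub_boxWindow : Prop := BoxWindowAll

end Registered

/-! ## Proved glue (no `sorry` below this line) -/

section Glue

/-! ### Pure real arithmetic of the two torus bounds -/

/-- Arithmetic of the torus LOWER bound: box lower bound `θ₁/D⁸`, one-point oscillations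
`C/(3ℓD)⁴` at both insertions, bad-set error `(θ₁/D⁸ + 16K²)·d`, smallness `64 C² ≤ θ₁ ℓ⁸` and
`(θ₁ + 16K²)·D⁸ d ≤ θ₁/4` give `θ₁/2 ≤ D⁸ · Cov`. -/
theorem lower_arith {θ₁ C ℓ D d K X : ℝ} (hθ : 0 < θ₁) (hℓ : 1 ≤ ℓ) (hD : 1 ≤ D)
    (hC : 64 * C ^ 2 ≤ θ₁ * ℓ ^ 8) (hd : 0 ≤ d)
    (hsmall : (θ₁ + 16 * K ^ 2) * (D ^ 8 * d) ≤ θ₁ / 4)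
    (h : θ₁ / D ^ 8 - C / (3 * ℓ * D) ^ 4 * (C / (3 * ℓ * D) ^ 4) / 4 -
        (θ₁ / D ^ 8 + 16 * K ^ 2) * d ≤ X) :
    θ₁ / 2 ≤ D ^ 8 * X := by
  have hD0 : 0 < D := by linarith
  have hℓ0 : 0 < ℓ := by linarith
  have hD8 : 0 < D ^ 8 := by positivity
  have hD8' : 1 ≤ D ^ 8 := one_le_pow₀ hD
  have hℓ8 : 0 ≤ ℓ ^ 8 := by positivity
  have e1 : D ^ 8 * (θ₁ / D ^ 8) = θ₁ := by field_simp
  have e2 : D ^ 8 * (C / (3 * ℓ * D) ^ 4 * (C / (3 * ℓ * D) ^ 4) / 4) =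
      C ^ 2 / (4 * 3 ^ 8 * ℓ ^ 8) := by
    field_simp
  have t2 : C ^ 2 / (4 * 3 ^ 8 * ℓ ^ 8) ≤ θ₁ / 4 := by
    rw [div_le_div_iff₀ (by positivity) (by positivity)]
    nlinarith [mul_nonneg hθ.le hℓ8]
  have e3 : D ^ 8 * ((θ₁ / D ^ 8 + 16 * K ^ 2) * d) = (θ₁ + 16 * K ^ 2 * D ^ 8) * d := by
    field_simp
  have t3 : (θ₁ + 16 * K ^ 2 * D ^ 8) * d ≤ θ₁ / 4 := by
    calc (θ₁ + 16 * K ^ 2 * D ^ 8) * d ≤ (θ₁ * D ^ 8 + 16 * K ^ 2 * D ^ 8) * d := by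
          apply mul_le_mul_of_nonneg_right _ hd
          nlinarith [sq_nonneg K]
      _ = (θ₁ + 16 * K ^ 2) * (D ^ 8 * d) := by ring
      _ ≤ θ₁ / 4 := hsmall
  have hmul := mul_le_mul_of_nonneg_left h hD8.le
  have expand : D ^ 8 * (θ₁ / D ^ 8 - C / (3 * ℓ * D) ^ 4 * (C / (3 * ℓ * D) ^ 4) / 4 -
      (θ₁ / D ^ 8 + 16 * K ^ 2) * d) =
      D ^ 8 * (θ₁ / D ^ 8) - D ^ 8 * (C / (3 * ℓ * D) ^ 4 * (C / (3 * ℓ * D) ^ 4) / 4) -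
        D ^ 8 * ((θ₁ / D ^ 8 + 16 * K ^ 2) * d) := by ring
  rw [expand, e1, e2, e3] at hmul
  linarith

/-- Arithmetic of the torus A-PRIORI bound: oscillations `C/R⁴` of the two one-box conditional
expectations, bad-set error `16K²d`, `D ≤ 4R` and `D⁸ d ≤ 1` give `|D⁸ Cov| ≤ 4⁷C² + 16K²`. -/
theorem apriori_arith {C K D R d X : ℝ} (hR : 0 < R) (hD : 0 ≤ D) (hDR : D ≤ 4 * R)
    (hd1 : D ^ 8 * d ≤ 1)
    (h : |X| ≤ C / R ^ 4 * (C / R ^ 4) / 4 + 16 * K ^ 2 * d) :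
    |D ^ 8 * X| ≤ 4 ^ 7 * C ^ 2 + 16 * K ^ 2 := by
  have hD8 : 0 ≤ D ^ 8 := by positivity
  rw [abs_mul, abs_of_nonneg hD8]
  have hq : D ^ 8 / R ^ 8 ≤ 4 ^ 8 := by
    rw [div_le_iff₀ (by positivity)]
    calc D ^ 8 ≤ (4 * R) ^ 8 := pow_le_pow_left₀ hD hDR 8
      _ = 4 ^ 8 * R ^ 8 := by ring
  have e : D ^ 8 * (C / R ^ 4 * (C / R ^ 4) / 4) = D ^ 8 / R ^ 8 * C ^ 2 / 4 := by
    field_simp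
  have hC2 : 0 ≤ C ^ 2 := sq_nonneg C
  have hK2 : 0 ≤ 16 * K ^ 2 := by positivity
  calc D ^ 8 * |X| ≤ D ^ 8 * (C / R ^ 4 * (C / R ^ 4) / 4 + 16 * K ^ 2 * d) :=
        mul_le_mul_of_nonneg_left h hD8
    _ = D ^ 8 / R ^ 8 * C ^ 2 / 4 + 16 * K ^ 2 * (D ^ 8 * d) := by rw [mul_add, e]; ring
    _ ≤ 4 ^ 8 * C ^ 2 / 4 + 16 * K ^ 2 * 1 := by gcongr
    _ = 4 ^ 7 * C ^ 2 + 16 * K ^ 2 := by ring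

/-! ### Bookkeeping: eventually bounded ⇒ bounded; re-indexing schemes; diagonal extraction -/

/-- An eventually bounded real sequence is bounded. -/
theorem exists_bound_of_eventually {u : ℕ → ℝ} {C : ℝ} (h : ∀ᶠ k in atTop, |u k| ≤ C) :
    ∃ C' : ℝ, ∀ k, |u k| ≤ C' := by
  obtain ⟨K, hK⟩ := eventually_atTop.1 h
  refine ⟨max C (∑ j ∈ Finset.range K, |u j|), fun k => ?_⟩
  rcases lt_or_ge k K with hk | hk
  · exact le_max_of_le_right
      (Finset.single_le_sum (fun j _ => abs_nonneg (u j)) (Finset.mem_range.2 hk))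
  · exact le_max_of_le_left (hK k hk)

variable {ι : Type}

/-- Re-indexing a scaling scheme along a strictly increasing `φ : ℕ → ℕ` (as in the disprover's
`Disproof.reindex`). -/
def reindex (sch : SpeciesScheme ι) (φ : ℕ → ℕ) (hφ : StrictMono φ) : SpeciesScheme ι where
  a := sch.a ∘ φ
  a_pos k := sch.a_pos (φ k)
  tendsto_a := sch.tendsto_a.comp hφ.tendsto_atTop
  β := sch.β ∘ φ
  L := sch.L ∘ φ
  tendsto_L := sch.tendsto_L.comp hφ.tendsto_atTop
  c s := sch.c s ∘ φ
  m s := sch.m s ∘ φ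

@[simp] theorem reindex_a (sch : SpeciesScheme ι) (φ : ℕ → ℕ) (hφ : StrictMono φ) (k : ℕ) :
    (reindex sch φ hφ).a k = sch.a (φ k) := rfl

@[simp] theorem reindex_β (sch : SpeciesScheme ι) (φ : ℕ → ℕ) (hφ : StrictMono φ) (k : ℕ) :
    (reindex sch φ hφ).β k = sch.β (φ k) := rfl

@[simp] theorem reindex_side (sch : SpeciesScheme ι) (φ : ℕ → ℕ) (hφ : StrictMono φ) (k : ℕ) :
    (reindex sch φ hφ).side k = sch.side (φ k) := rfl

variable {G : Type} [Group G] [TopologicalSpace G] [IsTopologicalGroup G] [CompactSpace G]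
  [MeasurableSpace G] [BorelSpace G]

/-- **Diagonal extraction** (the disprover's `window_of_windowBdd`, per `θ`): a tuned `M`-adic
witness with `β_k → ∞` along which every `N_t` is BOUNDED has a re-indexing along which every
`N_t` converges — the crux's clause (iii). -/
theorem witness_of_bounded (r : LatticeRep G) (M : ℕ) (θ : ℝ) (sch : SpeciesScheme (YMSpecies G))
    (n : ℕ → ℕ) (hshape : ∀ k, sch.a k = ((M : ℝ) ^ n k)⁻¹) (hβ : Tendsto sch.β atTop atTop)
    (hbdd : ∀ t : ℕ, 0 < t → ∃ C : ℝ, ∀ k, |((M : ℝ) ^ n k) ^ 8 *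
        latticeConnectedCorr r.ρ (sch.β k) (sch.side k) r.curvature.F r.curvature.F
          (t * M ^ n k)| ≤ C)
    (hlim : Tendsto (fun k => ((M : ℝ) ^ n k) ^ 8 *
        latticeConnectedCorr r.ρ (sch.β k) (sch.side k) r.curvature.F r.curvature.F
          (M ^ n k)) atTop (𝓝 θ)) :
    ∃ (sch' : SpeciesScheme (YMSpecies G)) (n' : ℕ → ℕ),
      (∀ k, sch'.a k = ((M : ℝ) ^ n' k)⁻¹) ∧ Tendsto sch'.β atTop atTop ∧
      (∀ t : ℕ, 0 < t → ∃ c : ℝ, Tendsto (fun k => ((M : ℝ) ^ n' k) ^ 8 *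
          latticeConnectedCorr r.ρ (sch'.β k) (sch'.side k) r.curvature.F r.curvature.F
            (t * M ^ n' k)) atTop (𝓝 c)) ∧
      Tendsto (fun k => ((M : ℝ) ^ n' k) ^ 8 *
          latticeConnectedCorr r.ρ (sch'.β k) (sch'.side k) r.curvature.F r.curvature.F
            (M ^ n' k)) atTop (𝓝 θ) := by
  set u : ℕ → ℕ → ℝ := fun k t' => ((M : ℝ) ^ n k) ^ 8 *
    latticeConnectedCorr r.ρ (sch.β k) (sch.side k) r.curvature.F r.curvature.F
      ((t' + 1) * M ^ n k) with hu
  choose C hC using fun t' : ℕ => hbdd (t' + 1) (Nat.succ_pos t')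
  set K : Set (ℕ → ℝ) := Set.pi Set.univ fun t' => Set.Icc (-C t') (C t') with hK
  have hKc : IsCompact K := isCompact_univ_pi fun t' => isCompact_Icc
  have huK : ∀ k, u k ∈ K := fun k => by
    simp only [hK, Set.mem_pi, Set.mem_univ, true_implies, Set.mem_Icc]
    intro t'
    exact abs_le.1 (hC t' k)
  obtain ⟨lim, -, φ, hφ, hconv⟩ := hKc.tendsto_subseq huK
  refine ⟨reindex sch φ hφ, n ∘ φ, fun k => hshape (φ k), hβ.comp hφ.tendsto_atTop, ?_, ?_⟩
  · intro t ht
    obtain ⟨t', rfl⟩ := Nat.exists_eq_succ_of_ne_zero ht.ne'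
    refine ⟨lim t', ?_⟩
    have h1 : Tendsto (fun j => u (φ j) t') atTop (𝓝 (lim t')) := tendsto_pi_nhds.1 hconv t'
    refine h1.congr fun j => ?_
    simp only [hu, Function.comp_apply, reindex_β, reindex_side, Nat.succ_eq_add_one]
  · exact hlim.comp hφ.tendsto_atTop

omit [Group G] [TopologicalSpace G] [IsTopologicalGroup G] [CompactSpace G] [BorelSpace G] in
/-- `configShift` by the zero vector is the identity (used to read the centre-plaquette instance
`x = c = 0` of clause (O) as a statement about the UNshifted density `P`). -/
theorem configShift_neg_zero_apply (U : LGConfig 4 G) :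
    configShift (-(0 : Fin 4 → ℤ)) U = U := by
  funext e
  rw [configShift_apply]
  simp

/-! ### The torus window from the three stubs, and the tuning -/

/-- **Localisation + tuning.** At fixed `(G, r, M)`, `M ≥ 2`: the Dirichlet-box window and the
two DLR inequalities give the crux body `Window r M` — with EXACT tuning `N_1(k) = θ` and the
a-priori bound `|N_t(k)| ≤ 4⁷C² + 16·(6N)²` WITHOUT reflection positivity. -/
theorem window_of_boxWindow (r : LatticeRep G) {M : ℕ} (hM : 2 ≤ M) (hW : BoxWindow r M)
    (hS : DLRCovarianceSplit r) (hDec : DLRDecoupling r) :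
    ∃ θ₀ : ℝ, 0 < θ₀ ∧ ∀ θ : ℝ, 0 < θ → θ < θ₀ →
      ∃ (sch : SpeciesScheme (YMSpecies G)) (n : ℕ → ℕ),
        (∀ k, sch.a k = ((M : ℝ) ^ n k)⁻¹) ∧ Tendsto sch.β atTop atTop ∧
        (∀ t : ℕ, 0 < t → ∃ c : ℝ, Tendsto (fun k => ((M : ℝ) ^ n k) ^ 8 *
            latticeConnectedCorr r.ρ (sch.β k) (sch.side k) r.curvature.F r.curvature.F
              (t * M ^ n k)) atTop (𝓝 c)) ∧
        Tendsto (fun k => ((M : ℝ) ^ n k) ^ 8 *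
            latticeConnectedCorr r.ρ (sch.β k) (sch.side k) r.curvature.F r.curvature.F
              (M ^ n k)) atTop (𝓝 θ) := by
  obtain ⟨θ₁, C, ℓ₀, β', δ, L₀, Bad, hθ₁, hC0, hℓ₀, hC, hβ', hδ0, hδ, hBad, hev⟩ := hW
  set K : ℝ := 6 * (r.N : ℝ) with hKdef
  have hM1 : 1 < M := by omega
  have hMR1 : (1 : ℝ) ≤ M := by exact_mod_cast hM1.le
  have hMR0 : (0 : ℝ) < M := by positivity
  have hℓR : (1 : ℝ) ≤ ℓ₀ := by exact_mod_cast hℓ₀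
  have hℓpos : 0 < ℓ₀ := hℓ₀
  -- eventual smallness of the bad-set errors and largeness of `M^n`
  have hev2 : ∀ᶠ n in atTop, (θ₁ + 16 * K ^ 2) * (((M : ℝ) ^ n) ^ 8 * δ n) ≤ θ₁ / 4 := by
    have h := hδ.const_mul (θ₁ + 16 * K ^ 2)
    rw [mul_zero] at h
    exact h.eventually (eventually_le_nhds (by positivity))
  have hev3 : ∀ᶠ n in atTop, ((M : ℝ) ^ n) ^ 8 * δ n ≤ 1 :=
    hδ.eventually (eventually_le_nhds one_pos)
  have hev4 : ∀ᶠ n in atTop, 12 ≤ M ^ n :=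
    (tendsto_pow_atTop_atTop_of_one_lt hM1).eventually_ge_atTop 12
  obtain ⟨N₀, hN₀⟩ := eventually_atTop.1 (hev.and (hev2.and (hev3.and hev4)))
  -- Step A: the torus lower bound at `β' n`, all large tori
  have hlow : ∀ n, N₀ ≤ n → ∀ L : ℕ, L₀ n ≤ L → 3 * ℓ₀ * M ^ n + 1 ≤ L →
      θ₁ / 2 ≤ ((M : ℝ) ^ n) ^ 8 *
        latticeConnectedCorr r.ρ (β' n) (2 * L + 1) r.curvature.F r.curvature.F (M ^ n) := by
    intro n hn L hL₀ hL
    obtain ⟨⟨hP, hU, hO⟩, hsmall, -, h12⟩ := hN₀ n hn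
    have hDpos : (0 : ℝ) < (M : ℝ) ^ n := by positivity
    have hD1 : (1 : ℝ) ≤ (M : ℝ) ^ n := one_le_pow₀ hMR1
    have hD8pos : (0 : ℝ) < ((M : ℝ) ^ n) ^ 8 := by positivity
    have h3ℓ : 0 < 3 * ℓ₀ := by omega
    have hmR : M ^ n ≤ 3 * ℓ₀ * M ^ n := Nat.le_mul_of_pos_left _ h3ℓ
    have hR1 : M ^ n ≤ 4 * (3 * ℓ₀ * M ^ n) := by omega
    have hR2 : 3 * ℓ₀ * M ^ n ≤ 3 * ℓ₀ * M ^ n := le_rfl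
    -- the one-point oscillation bound at the two insertions
    set a : ℝ := C / ((3 * ℓ₀ * M ^ n : ℕ) : ℝ) ^ 4 with ha
    have ha0 : 0 ≤ a := by positivity
    have hin0 : ∀ i : Fin 4, 2 * |(0 : Fin 4 → ℤ) i - (0 : Fin 4 → ℤ) i| ≤ ((3 * ℓ₀ * M ^ n : ℕ) : ℤ) :=
      fun i => by simp; positivity
    have hinD : ∀ i : Fin 4, 2 * |(Pi.single 0 ((M ^ n : ℕ) : ℤ) : Fin 4 → ℤ) i - (0 : Fin 4 → ℤ) i| ≤
        ((3 * ℓ₀ * M ^ n : ℕ) : ℤ) := by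
      intro i
      by_cases hi : i = 0
      · subst hi
        have : (2 : ℤ) * (M ^ n : ℕ) ≤ ((3 * ℓ₀ * M ^ n : ℕ) : ℤ) := by
          have h2 : 2 * M ^ n ≤ 3 * ℓ₀ * M ^ n := Nat.mul_le_mul_right _ (by omega)
          exact_mod_cast h2
        simpa [abs_of_nonneg] using this
      · simp [hi]; positivity
    have hA : ∀ η η' : LGConfig 4 G, η ∉ Bad n (3 * ℓ₀ * M ^ n) 0 → η' ∉ Bad n (3 * ℓ₀ * M ^ n) 0 →
        |(∫ U, r.curvature.F U ∂(ymSpecification r.ρ (β' n)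
              (((box 4 (3 * ℓ₀ * M ^ n)).image (· + (0 : Fin 4 → ℤ))) ×ˢ Finset.univ) η)) -
            ∫ U, r.curvature.F U ∂(ymSpecification r.ρ (β' n)
              (((box 4 (3 * ℓ₀ * M ^ n)).image (· + (0 : Fin 4 → ℤ))) ×ˢ Finset.univ) η')| ≤ a := by
      intro η η' hη hη'
      have h := hO (β' n) (3 * ℓ₀ * M ^ n) 0 0 η η' le_rfl hR1 hR2 hin0 hη hη'
      simpa only [configShift_neg_zero_apply] using h
    have hB : ∀ η η' : LGConfig 4 G, η ∉ Bad n (3 * ℓ₀ * M ^ n) 0 → η' ∉ Bad n (3 * ℓ₀ * M ^ n) 0 →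
        |(∫ U, r.curvature.F (configShift (-Pi.single 0 ((M ^ n : ℕ) : ℤ)) U)
              ∂(ymSpecification r.ρ (β' n)
                (((box 4 (3 * ℓ₀ * M ^ n)).image (· + (0 : Fin 4 → ℤ))) ×ˢ Finset.univ) η)) -
            ∫ U, r.curvature.F (configShift (-Pi.single 0 ((M ^ n : ℕ) : ℤ)) U)
              ∂(ymSpecification r.ρ (β' n)
                (((box 4 (3 * ℓ₀ * M ^ n)).image (· + (0 : Fin 4 → ℤ))) ×ˢ Finset.univ) η')| ≤
          a :=
      fun η η' hη hη' => hO (β' n) (3 * ℓ₀ * M ^ n) 0 _ η η' le_rfl hR1 hR2 hinD hη hη'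
    -- the box lower bound, as `θ₁ / D⁸ ≤ Cov_box`
    have hU' : ∀ η : LGConfig 4 G, η ∉ Bad n (3 * ℓ₀ * M ^ n) 0 →
        θ₁ / ((M : ℝ) ^ n) ^ 8 ≤
          (∫ U, r.curvature.F U * r.curvature.F (configShift (-Pi.single 0 ((M ^ n : ℕ) : ℤ)) U)
              ∂(ymSpecification r.ρ (β' n)
                (((box 4 (3 * ℓ₀ * M ^ n)).image (· + (0 : Fin 4 → ℤ))) ×ˢ Finset.univ) η)) -
            (∫ U, r.curvature.F U
              ∂(ymSpecification r.ρ (β' n)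
                (((box 4 (3 * ℓ₀ * M ^ n)).image (· + (0 : Fin 4 → ℤ))) ×ˢ Finset.univ) η)) *
              ∫ U, r.curvature.F (configShift (-Pi.single 0 ((M ^ n : ℕ) : ℤ)) U)
                ∂(ymSpecification r.ρ (β' n)
                  (((box 4 (3 * ℓ₀ * M ^ n)).image (· + (0 : Fin 4 → ℤ))) ×ˢ Finset.univ) η) := by
      intro η hη
      have h := hU η hη
      rw [div_le_iff₀ hD8pos]
      linarith
    -- torus-fit hypotheses
    have hfit : ∀ i : Fin 4, |(0 : Fin 4 → ℤ) i| + ((3 * ℓ₀ * M ^ n : ℕ) : ℤ) + 1 ≤ (L : ℤ) := by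
      intro i
      have : ((3 * ℓ₀ * M ^ n : ℕ) : ℤ) + 1 ≤ (L : ℤ) := by exact_mod_cast hL
      simpa using this
    have hmL : M ^ n + 1 ≤ L := le_trans (Nat.add_le_add_right hmR 1) hL
    have hp := hP (β' n) (3 * ℓ₀ * M ^ n) L 0 le_rfl hR1 hR2 hL₀
    have h := hS (β' n) (θ₁ / ((M : ℝ) ^ n) ^ 8) a a (δ n) (3 * ℓ₀ * M ^ n) L (M ^ n) 0
      (Bad n (3 * ℓ₀ * M ^ n) 0) (hBad _ _ _) hfit hmL (by positivity) ha0 ha0 (hδ0 n) hU' hA hB hp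
    -- arithmetic
    have hcast : ((3 * ℓ₀ * M ^ n : ℕ) : ℝ) = 3 * (ℓ₀ : ℝ) * (M : ℝ) ^ n := by push_cast; ring
    rw [ha, hcast] at h
    exact lower_arith hθ₁ hℓR hD1 hC (hδ0 n) hsmall h
  -- Step B: the a-priori bound at every `β ≥ β' n`, all `t ≥ 1`, all large tori
  have hapr : ∀ n, N₀ ≤ n → ∀ (β : ℝ) (t L : ℕ), β' n ≤ β → 1 ≤ t → L₀ n ≤ L →
      t * M ^ n + M ^ n ≤ L →
      |((M : ℝ) ^ n) ^ 8 *
        latticeConnectedCorr r.ρ β (2 * L + 1) r.curvature.F r.curvature.F (t * M ^ n)| ≤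
        4 ^ 7 * C ^ 2 + 16 * K ^ 2 := by
    intro n hn β t L hβ ht hL₀ hL
    obtain ⟨⟨hP, -, hO⟩, -, hd1, h12⟩ := hN₀ n hn
    set Rs : ℕ := M ^ n / 4 + 1 with hRs
    have hRs1 : 1 ≤ Rs := by omega
    have hDR : M ^ n ≤ 4 * Rs := by omega
    have h3ℓ : 0 < 3 * ℓ₀ := by omega
    have hmR : M ^ n ≤ 3 * ℓ₀ * M ^ n := Nat.le_mul_of_pos_left _ h3ℓ
    have hRsD : Rs ≤ M ^ n := by omega
    have hRs2 : Rs ≤ 3 * ℓ₀ * M ^ n := hRsD.trans hmR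
    have htD : M ^ n ≤ t * M ^ n := Nat.le_mul_of_pos_left _ ht
    have hsep : 2 * Rs + 3 ≤ t * M ^ n := by omega
    have hfit : t * M ^ n + Rs + 1 ≤ L := by omega
    set b : ℝ := C / ((Rs : ℕ) : ℝ) ^ 4 with hb
    have hb0 : 0 ≤ b := by positivity
    have hin0 : ∀ i : Fin 4, 2 * |(0 : Fin 4 → ℤ) i - (0 : Fin 4 → ℤ) i| ≤ ((Rs : ℕ) : ℤ) :=
      fun i => by simp
    have hinT : ∀ i : Fin 4, 2 * |(Pi.single 0 ((t * M ^ n : ℕ) : ℤ) : Fin 4 → ℤ) i -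
        (Pi.single 0 ((t * M ^ n : ℕ) : ℤ) : Fin 4 → ℤ) i| ≤ ((Rs : ℕ) : ℤ) :=
      fun i => by simp
    have hA : ∀ η η' : LGConfig 4 G, η ∉ Bad n Rs 0 → η' ∉ Bad n Rs 0 →
        |(∫ U, r.curvature.F U ∂(ymSpecification r.ρ β
              (((box 4 Rs).image (· + (0 : Fin 4 → ℤ))) ×ˢ Finset.univ) η)) -
            ∫ U, r.curvature.F U ∂(ymSpecification r.ρ β
              (((box 4 Rs).image (· + (0 : Fin 4 → ℤ))) ×ˢ Finset.univ) η')| ≤ b := by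
      intro η η' hη hη'
      have h := hO β Rs 0 0 η η' hβ hDR hRs2 hin0 hη hη'
      simpa only [configShift_neg_zero_apply] using h
    have hB : ∀ η η' : LGConfig 4 G, η ∉ Bad n Rs (Pi.single 0 ((t * M ^ n : ℕ) : ℤ)) →
        η' ∉ Bad n Rs (Pi.single 0 ((t * M ^ n : ℕ) : ℤ)) →
        |(∫ U, r.curvature.F (configShift (-Pi.single 0 ((t * M ^ n : ℕ) : ℤ)) U)
              ∂(ymSpecification r.ρ β
                (((box 4 Rs).image (· + (Pi.single 0 ((t * M ^ n : ℕ) : ℤ) : Fin 4 → ℤ))) ×ˢ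
                  Finset.univ) η)) -
            ∫ U, r.curvature.F (configShift (-Pi.single 0 ((t * M ^ n : ℕ) : ℤ)) U)
              ∂(ymSpecification r.ρ β
                (((box 4 Rs).image (· + (Pi.single 0 ((t * M ^ n : ℕ) : ℤ) : Fin 4 → ℤ))) ×ˢ
                  Finset.univ) η')| ≤ b :=
      fun η η' hη hη' => hO β Rs _ _ η η' hβ hDR hRs2 hinT hη hη'
    have hp1 := hP β Rs L 0 hβ hDR hRs2 hL₀
    have hp2 := hP β Rs L (Pi.single 0 ((t * M ^ n : ℕ) : ℤ)) hβ hDR hRs2 hL₀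
    have h := hDec β b b (δ n) Rs L (t * M ^ n) (Bad n Rs 0)
      (Bad n Rs (Pi.single 0 ((t * M ^ n : ℕ) : ℤ))) (hBad _ _ _) (hBad _ _ _) hRs1 hsep hfit hb0 hb0
      (hδ0 n) hA hB hp1 hp2
    have hRpos : (0 : ℝ) < ((Rs : ℕ) : ℝ) := by exact_mod_cast hRs1
    have hDRr : (M : ℝ) ^ n ≤ 4 * ((Rs : ℕ) : ℝ) := by exact_mod_cast hDR
    rw [hb] at h
    exact apriori_arith hRpos (by positivity) hDRr hd1 h
  -- Step C: tuning by the IVT at each step, and diagonal extraction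
  refine ⟨θ₁ / 2, by positivity, fun θ hθ hθlt => ?_⟩
  obtain ⟨nn, hnn⟩ : ∃ nn : ℕ → ℕ, ∀ k, nn k = N₀ + k := ⟨fun k => N₀ + k, fun _ => rfl⟩
  obtain ⟨LL, hLL⟩ : ∃ LL : ℕ → ℕ, ∀ k,
      LL k = L₀ (nn k) + 3 * ℓ₀ * M ^ nn k + (k + 2) * M ^ nn k + 1 :=
    ⟨fun k => L₀ (nn k) + 3 * ℓ₀ * M ^ nn k + (k + 2) * M ^ nn k + 1, fun _ => rfl⟩
  have hnnN : ∀ k, N₀ ≤ nn k := fun k => by rw [hnn]; omega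
  have hstar : ∀ k, θ₁ / 2 ≤ ((M : ℝ) ^ nn k) ^ 8 *
      latticeConnectedCorr r.ρ (β' (nn k)) (2 * LL k + 1) r.curvature.F r.curvature.F
        (M ^ nn k) := fun k =>
    hlow (nn k) (hnnN k) (LL k) (by rw [hLL]; omega) (by rw [hLL]; omega)
  choose β hββ' hβeq using fun k => exists_ge_corr_eq r M (nn k) (LL k) hθ hθlt (hstar k)
  have hMR1' : (1 : ℝ) < M := by exact_mod_cast hM1
  have hnn_top : Tendsto nn atTop atTop :=
    tendsto_atTop_mono (fun k => show k ≤ nn k by rw [hnn]; omega) tendsto_id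
  have hpow_top : Tendsto (fun k => (M : ℝ) ^ nn k) atTop atTop :=
    (tendsto_pow_atTop_atTop_of_one_lt hMR1').comp hnn_top
  have hkL : ∀ k, k * M ^ nn k ≤ LL k := fun k => by
    have h1 : k * M ^ nn k ≤ (k + 2) * M ^ nn k := Nat.mul_le_mul_right _ (by omega)
    have h2 : (k + 2) * M ^ nn k ≤ LL k := by rw [hLL]; omega
    exact h1.trans h2
  let sch : SpeciesScheme (YMSpecies G) :=
    { a := fun k => ((M : ℝ) ^ nn k)⁻¹
      a_pos := fun k => by positivity
      tendsto_a := tendsto_inv_atTop_zero.comp hpow_top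
      β := β
      L := LL
      tendsto_L := by
        refine tendsto_atTop_mono (fun k => ?_) tendsto_natCast_atTop_atTop
        have hLk : (k : ℝ) * (M : ℝ) ^ nn k ≤ LL k := by exact_mod_cast hkL k
        have hp : (0 : ℝ) < (M : ℝ) ^ nn k := by positivity
        show (k : ℝ) ≤ ((M : ℝ) ^ nn k)⁻¹ * (LL k : ℝ)
        rw [inv_mul_eq_div, le_div_iff₀ hp]
        exact hLk
      c := fun _ _ => 0
      m := fun _ _ => 0 }
  have hshape : ∀ k, sch.a k = ((M : ℝ) ^ nn k)⁻¹ := fun k => rfl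
  have hβtop : Tendsto sch.β atTop atTop :=
    tendsto_atTop_mono (fun k => hββ' k) (hβ'.comp hnn_top)
  have hlim : Tendsto (fun k => ((M : ℝ) ^ nn k) ^ 8 *
      latticeConnectedCorr r.ρ (sch.β k) (sch.side k) r.curvature.F r.curvature.F
        (M ^ nn k)) atTop (𝓝 θ) :=
    tendsto_const_nhds.congr fun k => (hβeq k).symm
  have hbdd : ∀ t : ℕ, 0 < t → ∃ C' : ℝ, ∀ k, |((M : ℝ) ^ nn k) ^ 8 *
      latticeConnectedCorr r.ρ (sch.β k) (sch.side k) r.curvature.F r.curvature.F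
        (t * M ^ nn k)| ≤ C' := by
    intro t ht
    refine exists_bound_of_eventually (C := 4 ^ 7 * C ^ 2 + 16 * K ^ 2) ?_
    refine eventually_atTop.2 ⟨t, fun k hk => ?_⟩
    have hL1 : L₀ (nn k) ≤ LL k := by rw [hLL]; omega
    have hL2 : t * M ^ nn k + M ^ nn k ≤ LL k := by
      have h1 : t * M ^ nn k ≤ k * M ^ nn k := Nat.mul_le_mul_right _ hk
      have h2 : (k + 2) * M ^ nn k = k * M ^ nn k + 2 * M ^ nn k := by ring
      rw [hLL]
      omega
    exact hapr (nn k) (hnnN k) (sch.β k) t (LL k) (hββ' k) ht hL1 hL2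
  exact witness_of_bounded r M θ sch nn hshape hβtop hbdd hlim

end Glue

/-! ## The composition: `stub_boxWindow` alone implies the crux, BY NAME (kernel-checked; no `sorry`
outside that one remaining stub) -/

/-- **`TunedSequenceExists_of`** — C⁺ (`stub_boxWindow`, the only remaining hypothesis) and the
two DLR inequalities (both PROVED: `dlrCovarianceSplitAll_holds` from the Literature theorem
`latticeConnectedCorr_ge_of_boxKernel_condCov`, `dlrDecouplingAll_holds` from the landed stub 3)
imply the crux
`Summit.QuantumFields.YangMills.Theses.ParabolicTrajectory.TunedSequenceExists` (localisation +
RP-free a-priori bound + IVT tuning + diagonal extraction, all proved above). -/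
theorem TunedSequenceExists_of (h₁ : Registered.stub_boxWindow) :
    Summit.QuantumFields.YangMills.Theses.ParabolicTrajectory.TunedSequenceExists := by
  intro G _ _ _ _ hG
  letI : MeasurableSpace G := borel G
  haveI : BorelSpace G := ⟨rfl⟩
  intro r M hM
  exact window_of_boxWindow r hM (h₁ G hG r M hM) (dlrCovarianceSplitAll_holds G r)
    (dlrDecouplingAll_holds G r)

/-- Wiring check: the registered stubs feed `TunedSequenceExists_of` as stated (the verbatim
restatements are definitionally the named statements). -/
example : Summit.QuantumFields.YangMills.Theses.ParabolicTrajectory.TunedSequenceExists :=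
  TunedSequenceExists_of stub_boxWindow

/-! ## Crux-sizedness certificate (lead c1, cycle 2, 2026-08-16)

The ONE open stub is not a sub-crux obligation: composed with the landed dissection lemmas of the
standing disproof it returns the crux's whole open core — the finite-volume correlator window lower
bound `CorrelatorWindowLowerBound r M` for EVERY compact simple `G`, faithful unitary `r`, `M ≥ 2`
(`Negative.Glue.lowerBound_of_tunedSequenceExists`; = the quantitative finite-volume `ξ(β) → ∞`,
Chatterjee Pb 5.1, registered open) — and the global non-uniform-clustering statement
(`Negative.UniformClustering.not_uniformClustering_of_tunedSequenceExists`).  Kernel-checked, so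
that "`stub_boxWindow` is crux-sized" is a theorem about the line and not an opinion: promoting
`BoxWindowAll` to an item (one-child glued split, glue = `TunedSequenceExists_of`) loses nothing,
and no reshape of THIS skeleton can produce a stub strictly below the crux's open input. -/

/-- `stub_boxWindow` ⇒ the correlator window lower bound for every admissible `(G, r, M)`
(the crux's open input, Disproof § Glue), via the crux itself. -/
theorem lowerBound_of_stub_boxWindow (h₁ : Registered.stub_boxWindow)
    (G : Type) [Group G] [TopologicalSpace G] [IsTopologicalGroup G] [CompactSpace G]
    (hG : IsCompactSimpleLieGroup G) :
    letI : MeasurableSpace G := borel G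
    haveI : BorelSpace G := ⟨rfl⟩
    ∀ (r : LatticeRep G) (M : ℕ), 2 ≤ M →
      ∃ θ₀ : ℝ, 0 < θ₀ ∧ ∀ (B : ℝ) (m₀ L₀ : ℕ), ∃ m : ℕ, m₀ ≤ m ∧ ∃ L : ℕ, L₀ * M ^ m ≤ L ∧
        ∃ β : ℝ, B ≤ β ∧ θ₀ ≤ ((M : ℝ) ^ m) ^ 8 *
          latticeConnectedCorr r.ρ β (2 * L + 1) r.curvature.F r.curvature.F (M ^ m) :=
  Summit.QuantumFields.YangMills.Theorems.TunedSequenceExists.Negative.Glue.lowerBound_of_tunedSequenceExists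
    (TunedSequenceExists_of h₁) G hG

/-- `stub_boxWindow` ⇒ NO compact simple lattice gauge theory (Wilson action, faithful unitary `r`)
clusters uniformly at weak coupling on the odd tori (Disproof § Clustering: the honest negation
target of the crux is inherited verbatim by the stub). -/
theorem not_uniformClustering_of_stub_boxWindow (h₁ : Registered.stub_boxWindow)
    (G : Type) [Group G] [TopologicalSpace G] [IsTopologicalGroup G] [CompactSpace G]
    (hG : IsCompactSimpleLieGroup G) :
    letI : MeasurableSpace G := borel G
    haveI : BorelSpace G := ⟨rfl⟩
    ∀ r : LatticeRep G, ¬ ∃ (β₁ m C : ℝ), 0 < m ∧ ∀ β : ℝ, β₁ ≤ β → ∀ L D : ℕ, D ≤ L →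
      |latticeConnectedCorr r.ρ β (2 * L + 1) r.curvature.F r.curvature.F D| ≤
        C * Real.exp (-(m * D)) :=
  Summit.QuantumFields.YangMills.Theorems.TunedSequenceExists.Negative.UniformClustering.not_uniformClustering_of_tunedSequenceExists
    (TunedSequenceExists_of h₁) G hG

end Summit.QuantumFields.YangMills.Cruxes.TunedSequenceExists.DirichletBoxLocalisation

end
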